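import Mathlib
import Literature.Combinatorics.Additive.TripleProductProperty

/-!
# `SnSubsetDichotomy.ThresholdSubsetTriples`, line `SketchIdeator2` — stub `stub_tpp_of_twistFree`

The triality lever of the ℤ/3-symmetric line of crux `stmt-MatrixMultiplication-10882`
(registered stub `stub_tpp_of_twistFree` of the lead's skeleton): for an element `τ` of a group
with `τ³ = 1` and a finite set `X`, if the *twisted corner* equation
`x₁x₁'⁻¹ · τ · x₂x₂'⁻¹ · τ · x₃x₃'⁻¹ · τ = 1` has only the trivial solutions `xᵢ = xᵢ'` in `X`,
then the triple `(X, τXτ⁻¹, τ²Xτ⁻²)` has the triple product property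
(`Literature.Combinatorics.Additive.TripleProductProperty`, Cohn–Umans 2003, Def. 2.1).

Proof: for `t = τbτ⁻¹`, `t' = τb'τ⁻¹`, `u = τ²cτ⁻²`, `u' = τ²c'τ⁻²` one has the group identity
`s s'⁻¹ · τ (b b'⁻¹) τ (c c'⁻¹) τ = (s s'⁻¹ · t t'⁻¹ · u u'⁻¹) · τ³`, so a TPP relation of the
triple is a twisted corner of `X`, hence trivial.  The general-group form is `TppOfTwistFree.tpp_of_twist`;
the registered `Equiv.Perm (Fin n)` statement is its specialisation.
-/

namespace Summit.MatrixMultiplication.MatrixMultiplication.Theorems.ThresholdSubsetTriples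

open Literature.Combinatorics.Additive

namespace TppOfTwistFree

-- `Summit.<Summit>.<Problem>` is the tree's mandated summit-side namespace; for this single-conjunct
-- summit the two coincide (`MatrixMultiplication.MatrixMultiplication`), so each declaration
-- silences `dupNamespace`, as in the landed siblings `SnSubsetDichotomy*Stub*.lean`.

-- adapted from Cruxes/ThresholdSubsetTriples/SketchIdeator3.lean (tpp_of_twist)
set_option linter.dupNamespace false in -- deliberate `Summit.<S>.<P>` duplicate
/-- If `γ³ = 1` and the twisted corner equation `a a'⁻¹ γ (b b'⁻¹) γ (c c'⁻¹) γ = 1` has only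
trivial solutions in the finite set `X`, then `(X, γXγ⁻¹, γ²Xγ⁻²)` has the triple product
property: a TPP relation `s s'⁻¹ (t t'⁻¹) (u u'⁻¹) = 1` with `t, t' ∈ γXγ⁻¹`, `u, u' ∈ γ²Xγ⁻²`
is, after multiplying by `γ³ = 1` on the right, a twisted corner of `X`. [folklore] -/
theorem tpp_of_twist {G : Type*} [Group G] [DecidableEq G] (X : Finset G) (γ : G)
    (hγ : γ ^ 3 = 1)
    (htw : ∀ a ∈ X, ∀ a' ∈ X, ∀ b ∈ X, ∀ b' ∈ X, ∀ c ∈ X, ∀ c' ∈ X,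
      a * a'⁻¹ * γ * (b * b'⁻¹) * γ * (c * c'⁻¹) * γ = 1 → a = a' ∧ b = b' ∧ c = c') :
    TripleProductProperty X (X.image (fun x => γ * x * γ⁻¹))
      (X.image (fun x => γ ^ 2 * x * (γ ^ 2)⁻¹)) := by
  intro s hs s' hs' t ht t' ht' u hu u' hu' hprod
  obtain ⟨b, hb, rfl⟩ := Finset.mem_image.mp ht
  obtain ⟨b', hb', rfl⟩ := Finset.mem_image.mp ht'
  obtain ⟨c, hc, rfl⟩ := Finset.mem_image.mp hu
  obtain ⟨c', hc', rfl⟩ := Finset.mem_image.mp hu'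
  -- the TPP relation of the twisted triple is a twisted corner of `X`, up to the factor `γ³ = 1`
  have key : s * s'⁻¹ * γ * (b * b'⁻¹) * γ * (c * c'⁻¹) * γ = 1 := by
    calc s * s'⁻¹ * γ * (b * b'⁻¹) * γ * (c * c'⁻¹) * γ
        = (s * s'⁻¹ * (γ * b * γ⁻¹ * (γ * b' * γ⁻¹)⁻¹) *
            (γ ^ 2 * c * (γ ^ 2)⁻¹ * (γ ^ 2 * c' * (γ ^ 2)⁻¹)⁻¹)) * γ ^ 3 := by group
      _ = 1 := by rw [hprod, hγ, one_mul]
  obtain ⟨h1, h2, h3⟩ := htw s hs s' hs' b hb b' hb' c hc c' hc' key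
  subst h1; subst h2; subst h3
  exact ⟨rfl, rfl, rfl⟩

end TppOfTwistFree

set_option linter.dupNamespace false in -- deliberate `Summit.<S>.<P>` duplicate
/-- **Stub `stub_tpp_of_twistFree` (the triality lever)** (line `SketchIdeator2` of crux
`SnSubsetDichotomy.ThresholdSubsetTriples`, stmt-MatrixMultiplication-10882).  If `τ³ = 1` in
`S_n` and the finite set `X ⊆ S_n` has only trivial twisted corners
(`x₁x₁'⁻¹ τ (x₂x₂'⁻¹) τ (x₃x₃'⁻¹) τ = 1 ⟹ xᵢ = xᵢ'`), then `(X, τXτ⁻¹, τ²Xτ⁻²)` has the triple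
product property (`TppOfTwistFree.tpp_of_twist` specialised to `Equiv.Perm (Fin n)`). [folklore] -/
theorem stub_tpp_of_twistFree : ∀ (n : ℕ) (τ : Equiv.Perm (Fin n)) (X : Finset (Equiv.Perm (Fin n))), τ ^ 3 = 1 → (∀ x₁ ∈ X, ∀ x₁' ∈ X, ∀ x₂ ∈ X, ∀ x₂' ∈ X, ∀ x₃ ∈ X, ∀ x₃' ∈ X, x₁ * x₁'⁻¹ * τ * (x₂ * x₂'⁻¹) * τ * (x₃ * x₃'⁻¹) * τ = 1 → x₁ = x₁' ∧ x₂ = x₂' ∧ x₃ = x₃') → TripleProductProperty X (X.image (fun x => τ * x * τ⁻¹)) (X.image (fun x => τ ^ 2 * x * (τ ^ 2)⁻¹)) :=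
  fun _ τ X hτ htw => TppOfTwistFree.tpp_of_twist X τ hτ htw

end Summit.MatrixMultiplication.MatrixMultiplication.Theorems.ThresholdSubsetTriples
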